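import Mathlib
import Summits.Ventures.PercRepro2.RootBridgeStates

/-!
# Both roots behind an unmarked cut vertex, I: the kernel on the states (blind cell PercRepro2,
p3 g3, 2026-08-25; `proofs/P3-BRIDGE.md` §11)

When an unmarked vertex `c` is a cut vertex of the support separating the side `VH ∋ a₁, a₂` from
the side `VL ∋ o, b, a₃`, a copy of the support has the state `cutRootsSt s go gb g3` with
`s : HState` the set partition of `{a₁, c, a₂}` induced by the root side (read through
`hstC ends a₁ c a₂`: `hv = a₁ ↔ c`, `h3 = a₂ ↔ c`, `v3 = a₁ ↔ a₂`) and `go, gb, g3` the connections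
`c ↔ o`, `c ↔ b`, `c ↔ a₃` on the other side: `q' = v3` and every `L`-coordinate is `hv ∧ g`,
every `H`-coordinate `h3 ∧ g`.  On these states the kernel `KB` is the FIVE-monomial expansion
`KB = rKa·(lA + lB') − rKb·lB + rKc·(lG − lG')` (`KB_cutRootsSt`: `125` root-state triples, a `decide` over the
`2⁹` far-side bit patterns each): the root side enters only through `P = 1[a₁ ↮ a₂]` and the
sign `e = 1[a₁ ↔ c] − 1[a₂ ↔ c]` of each copy, and `rKa − rKb = P P P·(|e_y||e_w| − e_y e_w)` is
pointwise nonnegative (`rKa_sub_rKb_nonneg`).  Own work; standard axioms.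
-/

namespace Summit.Ventures.PercRepro2

namespace CovForm

namespace RootBridge

open OneTyped

/-- The state of a copy of the support when the roots sit behind the unmarked cut vertex `c`:
`s` the root-side partition of `{a₁, c, a₂}` (`hv = a₁ ↔ c`, `h3 = a₂ ↔ c`, `v3 = a₁ ↔ a₂`),
`go, gb, g3` the far-side connections `c ↔ o`, `c ↔ b`, `c ↔ a₃`. -/
def cutRootsSt (s : HState) (go gb g3 : Bool) : St :=
  (s.v3, s.hv && go, s.h3 && go, s.hv && gb, s.h3 && gb, s.hv && g3, s.h3 && g3)

/-- `1[a₁ ↮ a₂]` of a root-side state. -/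
def pR (s : HState) : ℤ := if s.v3 then 0 else 1

/-- The sign `1[a₁ ↔ c] − 1[a₂ ↔ c]` of a root-side state. -/
def eR (s : HState) : ℤ := (if s.hv then 1 else 0) - (if s.h3 then 1 else 0)

/-- `|1[a₁ ↔ c] − 1[a₂ ↔ c]|` of a root-side state. -/
def aR (s : HState) : ℤ := if s.hv == s.h3 then 0 else 1

/-- The root-side coefficient of the same-sign monomials: `P_x P_y P_w |e_y| |e_w|`. -/
def rKa (sx sy sw : HState) : ℤ := pR sx * pR sy * pR sw * (aR sy * aR sw)

/-- The root-side coefficient of the cross monomial: `P_x P_y P_w e_y e_w`. -/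
def rKb (sx sy sw : HState) : ℤ := pR sx * pR sy * pR sw * (eR sy * eR sw)

/-- The root-side coefficient of the two cancelling monomials: `P_x P_y P_w e_y e_w |e_x|`. -/
def rKc (sx sy sw : HState) : ℤ := pR sx * pR sy * pR sw * (eR sy * eR sw * aR sx)

/-- `1[o ∈ C(c), a₃ ∉ C(c)]` of a far-side state. -/
def lA (go _gb g3 : Bool) : ℤ := if go && !g3 then 1 else 0

/-- `1[b ∈ C(c)]` of a far-side state. -/
def lB (_go gb _g3 : Bool) : ℤ := if gb then 1 else 0

/-- `1[b ∈ C(c), a₃ ∉ C(c)]` of a far-side state. -/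
def lB' (_go gb g3 : Bool) : ℤ := if gb && !g3 then 1 else 0

/-- `1[b ∈ C(c), a₃ ∈ C(c)]` of a far-side state. -/
def lC (_go gb g3 : Bool) : ℤ := if gb && g3 then 1 else 0

/-- `1[a₃ ∈ C(c)]` of a far-side state. -/
def l3 (_go _gb g3 : Bool) : ℤ := if g3 then 1 else 0

/-- The five-monomial expansion of the kernel on cut-roots states. -/
def cutRootsExp (sx : HState) (gox gbx g3x : Bool) (sy : HState) (goy gby g3y : Bool)
    (sw : HState) (gow gbw g3w : Bool) : ℤ :=
  rKa sx sy sw * (lA goy gby g3y * lC gow gbw g3w + lB' goy gby g3y * lA gow gbw g3w) -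
    rKb sx sy sw * (lB goy gby g3y * lA gow gbw g3w) +
    rKc sx sy sw * (l3 gox gbx g3x * lB goy gby g3y * lA gow gbw g3w -
      lA gox gbx g3x * lB goy gby g3y * l3 gow gbw g3w)

/-- The expansion when the first copy has the root state `A` (`decide`, 25 × 512 cases). -/
theorem KB_cutRootsSt_A (gox gbx g3x : Bool) (sy : HState) (goy gby g3y : Bool) (sw : HState)
    (gow gbw g3w : Bool) :
    KB (cutRootsSt HState.A gox gbx g3x) (cutRootsSt sy goy gby g3y)
        (cutRootsSt sw gow gbw g3w) =
      cutRootsExp HState.A gox gbx g3x sy goy gby g3y sw gow gbw g3w := by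
  cases sy <;> cases sw <;> (revert gox gbx g3x goy gby g3y gow gbw g3w; decide +kernel)

/-- The expansion when the first copy has the root state `B` (`decide`, 25 × 512 cases). -/
theorem KB_cutRootsSt_B (gox gbx g3x : Bool) (sy : HState) (goy gby g3y : Bool) (sw : HState)
    (gow gbw g3w : Bool) :
    KB (cutRootsSt HState.B gox gbx g3x) (cutRootsSt sy goy gby g3y)
        (cutRootsSt sw gow gbw g3w) =
      cutRootsExp HState.B gox gbx g3x sy goy gby g3y sw gow gbw g3w := by
  cases sy <;> cases sw <;> (revert gox gbx g3x goy gby g3y gow gbw g3w; decide +kernel)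

/-- The expansion when the first copy has the root state `C` (`decide`, 25 × 512 cases). -/
theorem KB_cutRootsSt_C (gox gbx g3x : Bool) (sy : HState) (goy gby g3y : Bool) (sw : HState)
    (gow gbw g3w : Bool) :
    KB (cutRootsSt HState.C gox gbx g3x) (cutRootsSt sy goy gby g3y)
        (cutRootsSt sw gow gbw g3w) =
      cutRootsExp HState.C gox gbx g3x sy goy gby g3y sw gow gbw g3w := by
  cases sy <;> cases sw <;> (revert gox gbx g3x goy gby g3y gow gbw g3w; decide +kernel)

/-- The expansion when the first copy has the root state `D` (`decide`, 25 × 512 cases). -/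
theorem KB_cutRootsSt_D (gox gbx g3x : Bool) (sy : HState) (goy gby g3y : Bool) (sw : HState)
    (gow gbw g3w : Bool) :
    KB (cutRootsSt HState.D gox gbx g3x) (cutRootsSt sy goy gby g3y)
        (cutRootsSt sw gow gbw g3w) =
      cutRootsExp HState.D gox gbx g3x sy goy gby g3y sw gow gbw g3w := by
  cases sy <;> cases sw <;> (revert gox gbx g3x goy gby g3y gow gbw g3w; decide +kernel)

/-- The expansion when the first copy has the root state `E` (`decide`, 25 × 512 cases). -/
theorem KB_cutRootsSt_E (gox gbx g3x : Bool) (sy : HState) (goy gby g3y : Bool) (sw : HState)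
    (gow gbw g3w : Bool) :
    KB (cutRootsSt HState.E gox gbx g3x) (cutRootsSt sy goy gby g3y)
        (cutRootsSt sw gow gbw g3w) =
      cutRootsExp HState.E gox gbx g3x sy goy gby g3y sw gow gbw g3w := by
  cases sy <;> cases sw <;> (revert gox gbx g3x goy gby g3y gow gbw g3w; decide +kernel)

/-- **The kernel on cut-roots states is the five-monomial expansion** (`125 · 512` cases). -/
theorem KB_cutRootsSt (sx : HState) (gox gbx g3x : Bool) (sy : HState) (goy gby g3y : Bool)
    (sw : HState) (gow gbw g3w : Bool) :
    KB (cutRootsSt sx gox gbx g3x) (cutRootsSt sy goy gby g3y) (cutRootsSt sw gow gbw g3w) =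
      cutRootsExp sx gox gbx g3x sy goy gby g3y sw gow gbw g3w := by
  cases sx
  · exact KB_cutRootsSt_A gox gbx g3x sy goy gby g3y sw gow gbw g3w
  · exact KB_cutRootsSt_B gox gbx g3x sy goy gby g3y sw gow gbw g3w
  · exact KB_cutRootsSt_C gox gbx g3x sy goy gby g3y sw gow gbw g3w
  · exact KB_cutRootsSt_D gox gbx g3x sy goy gby g3y sw gow gbw g3w
  · exact KB_cutRootsSt_E gox gbx g3x sy goy gby g3y sw gow gbw g3w

/-- **The root-side coefficient `rKa − rKb` is nonnegative**: it is `P_x P_y P_w · 2` when the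
copies `y, w` see the cut vertex from opposite roots and `0` otherwise. -/
theorem rKa_sub_rKb_nonneg (sx sy sw : HState) : 0 ≤ rKa sx sy sw - rKb sx sy sw := by
  revert sx sy sw
  decide +kernel

end RootBridge

end CovForm

end Summit.Ventures.PercRepro2
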